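import Summits.ValiantsHypothesis.ValiantsHypothesis.Theorems.LacunarySymmetroidMatrixDescartesCensusSecularRolle

/-!
# `MatrixDescartes` census — TANGENCY LAW for `2 × 2` symmetric pencils (pivot column, m = 2)

HONEST FRAMING.  A structure lemma for the object-search cell `pub-symmetroid`'s pivot column
(`…CensusPivotDefs`: `pivotPosRoots`, `PivotRootLawAt`; the open m = 2 row «(2,K) ≤ 2K», located
cell (2,4)₁ ∈ {8,9,10}).  Landed `--supports stmt-ValiantsHypothesis-18050` as a helper; it proves NO bound
on any pivot row and says nothing about `Theses.LacunarySymmetroid.MatrixDescartes`, DoorA26/DoorA34,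
the census registers or `VP ≠ VNP`.

THE LAW.  Let `F(X) = X^e • J + ∑ₖ X^{d k} • P k` with `J`, `P k` ANY real symmetric `2 × 2` matrices (no
sign, index or semidefiniteness hypothesis), and let `u₀` be a MULTIPLE real root of `det F`
(`det F` and its derivative both vanish at `u₀`) with `F(u₀) ≠ 0`.  Then every kernel vector `w` of `F(u₀)`
is isotropic for the derivative matrix: `wᵀ F'(u₀) w = 0` (`tangency_quadForm_derivative_eq_zero`), hence
(combining with `wᵀ F(u₀) w = 0`) the BALANCE LAW
`∑ₖ (d k − e) · u₀^{d k} · wᵀ (P k) w = 0` (`tangency_balance`): in a kernel direction the letters above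
the pivot exponent and the letters below it carry equal weighted mass; consequently the «velocity letter»
`B(u₀) = ∑ₖ (d k − e) u₀^{d k} • P k = u₀ A'(u₀) − e A(u₀)` is not definite, `det B(u₀) ≤ 0`
(`tangency_det_velocity_nonpos`).  In the scalar normal form of `…CensusPivotTwoEnvelope` this is the
statement that local extrema of the envelope `Λ` (double roots of `det F` at every level) occur only where
the velocity `C'(t) = ∑ (d k − e) e^{(d k − e)t} q k` of the letter curve is spacelike or null — the kernel
form of the located observation that every near-extremal (2,K) configuration is a high-contact
(near-tangent) one.  A zero-forcing search for `2K + 1` positive roots must pass through such a tangency.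

[folklore] Jacobi's formula `(det F)' = tr(adj F · F')` for `2 × 2` matrices and elementary algebra.
-/

-- `Summit.ValiantsHypothesis.ValiantsHypothesis.…` repeats a component by the D-0017 layout
-- (single-conjunct summit), which the `dupNamespace` linter flags; the name is mandated.
set_option linter.dupNamespace false

namespace Summit.ValiantsHypothesis.ValiantsHypothesis.Theorems.LacunarySymmetroidMatrixDescartes.Pivot.Tangency

open Polynomial Matrix Finset
open scoped BigOperators

/-! ## The algebraic core: a rank-one symmetric `2 × 2` matrix, a kernel vector, Jacobi's formula -/

/-- **Core identity.**  If `[[a,b],[b,c]]` is a NON-ZERO singular symmetric matrix (`a c = b²`), `(x,y)` is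
in its kernel, and `a' c + a c' − 2 b b' = 0` (the derivative of the determinant along a direction
`[[a',b'],[b',c']]` vanishes), then `(x,y)` is isotropic for `[[a',b'],[b',c']]`. [folklore] -/
theorem core_isotropic (a b c a' b' c' x y : ℝ) (hdet : a * c = b ^ 2)
    (hne : ¬ (a = 0 ∧ b = 0 ∧ c = 0)) (hder : a' * c + a * c' - 2 * b * b' = 0)
    (h1 : a * x + b * y = 0) (h2 : b * x + c * y = 0) :
    a' * x ^ 2 + 2 * b' * x * y + c' * y ^ 2 = 0 := by
  set T := a' * x ^ 2 + 2 * b' * x * y + c' * y ^ 2 with hT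
  -- `a · T = 0` and `c · T = 0`
  have haT : a * T = 0 := by
    have : a * T = -a' * y * (b * x + c * y) + (a * c' - 2 * b * b' + a' * c) * y ^ 2
        + a' * x * (a * x + b * y) + 2 * b' * y * (a * x + b * y) := by
      rw [hT]; ring
    rw [this, h1, h2]
    have : a * c' - 2 * b * b' + a' * c = 0 := by linarith
    rw [this]; ring
  have hcT : c * T = 0 := by
    have : c * T = -c' * x * (a * x + b * y) + (a' * c - 2 * b * b' + a * c') * x ^ 2
        + c' * y * (b * x + c * y) + 2 * b' * x * (b * x + c * y) := by
      rw [hT]; ring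
    rw [this, h1, h2]
    have : a' * c - 2 * b * b' + a * c' = 0 := by linarith
    rw [this]; ring
  by_cases ha : a = 0
  · by_cases hc : c = 0
    · exfalso
      have hb : b = 0 := by
        have : b ^ 2 = 0 := by rw [← hdet, ha, zero_mul]
        exact pow_eq_zero_iff (n := 2) (by norm_num) |>.1 this
      exact hne ⟨ha, hb, hc⟩
    · exact (mul_eq_zero.1 hcT).resolve_left hc
  · exact (mul_eq_zero.1 haT).resolve_left ha

/-- A real symmetric `2 × 2` quadratic form with a non-zero isotropic vector is not definite:
`α x² + 2 β x y + γ y² = 0`, `(x,y) ≠ 0` ⇒ `α γ − β² ≤ 0`. [folklore] -/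
theorem det_nonpos_of_isotropic (α β γ x y : ℝ) (hxy : ¬ (x = 0 ∧ y = 0))
    (h : α * x ^ 2 + 2 * β * x * y + γ * y ^ 2 = 0) : α * γ - β ^ 2 ≤ 0 := by
  by_contra hpos
  rw [not_le] at hpos
  have hα : α ≠ 0 := by
    intro hα; rw [hα, zero_mul, zero_sub] at hpos; nlinarith [sq_nonneg β]
  -- α · form = (α x + β y)² + (αγ − β²) y²
  have key : α * (α * x ^ 2 + 2 * β * x * y + γ * y ^ 2) = (α * x + β * y) ^ 2 + (α * γ - β ^ 2) * y ^ 2 := by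
    ring
  rw [h, mul_zero] at key
  have hy : y = 0 := by
    by_contra hy
    have : 0 < (α * γ - β ^ 2) * y ^ 2 := mul_pos hpos (by positivity)
    nlinarith [sq_nonneg (α * x + β * y)]
  have hx : x = 0 := by
    rw [hy] at key
    have : (α * x + β * 0) ^ 2 = 0 := by nlinarith [sq_nonneg (α * x + β * 0)]
    have h' : α * x = 0 := by simpa using pow_eq_zero_iff (n := 2) (by norm_num) |>.1 this
    exact (mul_eq_zero.1 h').resolve_left hα
  exact hxy ⟨hx, hy⟩

/-! ## The pencil, its value and its derivative at a point -/

variable {K : ℕ}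

/-! Throughout, the pencil is `F(X) = X^e • J + ∑ₖ X^{d k} • P k` (a `2 × 2` matrix of real polynomials, the
matrix whose determinant `Pivot.pivotPosRoots` counts the positive roots of), its value at `u` is
`F(u) = u^e • J + ∑ₖ u^{d k} • P k`, its derivative is `F'(u) = e u^{e−1} • J + ∑ₖ (d k) u^{d k − 1} • P k`
(natural-number exponents; terms with exponent `0` vanish through the factor `0`), and the «velocity letter» is
`B(u) = ∑ₖ (d k − e) u^{d k} • P k = u A'(u) − e A(u)` (`A = ∑ u^{d k} P k`, `d k − e` the real difference);
all four are written out in full in every statement (no definitions, no notation). -/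

/-- Entries of the pencil: `F i j = X^e · C (J i j) + ∑ₖ X^{d k} · C (P k i j)`. -/
theorem pencil_apply (e : ℕ) (d : Fin K → ℕ) (J : Matrix (Fin 2) (Fin 2) ℝ)
    (P : Fin K → Matrix (Fin 2) (Fin 2) ℝ) (i j : Fin 2) :
    (((Polynomial.X : ℝ[X]) ^ e) • Matrix.map J Polynomial.C
      + ∑ k, ((Polynomial.X : ℝ[X]) ^ d k) • Matrix.map (P k) Polynomial.C) i j = (X : ℝ[X]) ^ e * Polynomial.C (J i j) + ∑ k, (X : ℝ[X]) ^ d k * Polynomial.C (P k i j) := by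
  simp [Matrix.add_apply, Matrix.smul_apply, Matrix.sum_apply, Matrix.map_apply, smul_eq_mul]

/-- Evaluating an entry of the pencil at `u` gives the entry of `F(u)`. -/
theorem eval_pencil_apply (e : ℕ) (d : Fin K → ℕ) (J : Matrix (Fin 2) (Fin 2) ℝ)
    (P : Fin K → Matrix (Fin 2) (Fin 2) ℝ) (u : ℝ) (i j : Fin 2) :
    ((((Polynomial.X : ℝ[X]) ^ e) • Matrix.map J Polynomial.C
      + ∑ k, ((Polynomial.X : ℝ[X]) ^ d k) • Matrix.map (P k) Polynomial.C) i j).eval u = (u ^ e • J + ∑ k, u ^ d k • P k) i j := by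
  simp only [Matrix.add_apply, Matrix.smul_apply, Matrix.sum_apply, Matrix.map_apply, smul_eq_mul,
    Polynomial.eval_add, Polynomial.eval_mul, Polynomial.eval_pow, Polynomial.eval_X, Polynomial.eval_C,
    Polynomial.eval_finsetSum]

/-- Evaluating the DERIVATIVE of an entry of the pencil at `u` gives the entry of `F'(u)`. -/
theorem eval_derivative_pencil_apply (e : ℕ) (d : Fin K → ℕ) (J : Matrix (Fin 2) (Fin 2) ℝ)
    (P : Fin K → Matrix (Fin 2) (Fin 2) ℝ) (u : ℝ) (i j : Fin 2) :
    (Polynomial.derivative ((((Polynomial.X : ℝ[X]) ^ e) • Matrix.map J Polynomial.C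
      + ∑ k, ((Polynomial.X : ℝ[X]) ^ d k) • Matrix.map (P k) Polynomial.C) i j)).eval u = ((((e : ℕ) : ℝ) * u ^ (e - 1)) • J + ∑ k, (((d k : ℕ) : ℝ) * u ^ (d k - 1)) • P k) i j := by
  simp only [Matrix.add_apply, Matrix.smul_apply, Matrix.sum_apply, Matrix.map_apply, smul_eq_mul,
    Polynomial.derivative_add, Polynomial.derivative_sum, Polynomial.derivative_mul, Polynomial.derivative_X_pow,
    Polynomial.derivative_C, mul_zero, add_zero, Polynomial.eval_add, Polynomial.eval_mul, Polynomial.eval_pow,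
    Polynomial.eval_X, Polynomial.eval_C, Polynomial.eval_finsetSum]

/-- The determinant of the pencil, evaluated at `u`, is `det F(u)` written out for `2 × 2` matrices. -/
theorem eval_det_pencil (e : ℕ) (d : Fin K → ℕ) (J : Matrix (Fin 2) (Fin 2) ℝ)
    (P : Fin K → Matrix (Fin 2) (Fin 2) ℝ) (u : ℝ) :
    ((((Polynomial.X : ℝ[X]) ^ e) • Matrix.map J Polynomial.C
      + ∑ k, ((Polynomial.X : ℝ[X]) ^ d k) • Matrix.map (P k) Polynomial.C)).det.eval u
      = (u ^ e • J + ∑ k, u ^ d k • P k) 0 0 * (u ^ e • J + ∑ k, u ^ d k • P k) 1 1 - (u ^ e • J + ∑ k, u ^ d k • P k) 0 1 * (u ^ e • J + ∑ k, u ^ d k • P k) 1 0 := by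
  rw [Matrix.det_fin_two, Polynomial.eval_sub, Polynomial.eval_mul, Polynomial.eval_mul,
    eval_pencil_apply, eval_pencil_apply, eval_pencil_apply, eval_pencil_apply]

/-- **Jacobi's formula at a point (2 × 2).**  The derivative of `det F`, evaluated at `u`, is
`F₀₀' F₁₁ + F₀₀ F₁₁' − F₀₁' F₁₀ − F₀₁ F₁₀'` with `F = F(u)`, `F' = F'(u)`. [folklore] -/
theorem eval_derivative_det_pencil (e : ℕ) (d : Fin K → ℕ) (J : Matrix (Fin 2) (Fin 2) ℝ)
    (P : Fin K → Matrix (Fin 2) (Fin 2) ℝ) (u : ℝ) :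
    (Polynomial.derivative ((((Polynomial.X : ℝ[X]) ^ e) • Matrix.map J Polynomial.C
      + ∑ k, ((Polynomial.X : ℝ[X]) ^ d k) • Matrix.map (P k) Polynomial.C)).det).eval u
      = ((((e : ℕ) : ℝ) * u ^ (e - 1)) • J + ∑ k, (((d k : ℕ) : ℝ) * u ^ (d k - 1)) • P k) 0 0 * (u ^ e • J + ∑ k, u ^ d k • P k) 1 1 + (u ^ e • J + ∑ k, u ^ d k • P k) 0 0 * ((((e : ℕ) : ℝ) * u ^ (e - 1)) • J + ∑ k, (((d k : ℕ) : ℝ) * u ^ (d k - 1)) • P k) 1 1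
        - (((((e : ℕ) : ℝ) * u ^ (e - 1)) • J + ∑ k, (((d k : ℕ) : ℝ) * u ^ (d k - 1)) • P k) 0 1 * (u ^ e • J + ∑ k, u ^ d k • P k) 1 0 + (u ^ e • J + ∑ k, u ^ d k • P k) 0 1 * ((((e : ℕ) : ℝ) * u ^ (e - 1)) • J + ∑ k, (((d k : ℕ) : ℝ) * u ^ (d k - 1)) • P k) 1 0) := by
  rw [Matrix.det_fin_two, Polynomial.derivative_sub, Polynomial.derivative_mul, Polynomial.derivative_mul]
  simp only [Polynomial.eval_sub, Polynomial.eval_add, Polynomial.eval_mul, eval_pencil_apply,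
    eval_derivative_pencil_apply]

/-! ## The tangency law -/

/-- **TANGENCY LAW (isotropy of the derivative).**  `J`, `P k` real symmetric `2 × 2` (no further
hypothesis).  If `u₀` is a multiple root of `det F` (`det F` and its derivative vanish at `u₀`), `F(u₀) ≠ 0`,
and `w` is a kernel vector of `F(u₀)`, then `wᵀ F'(u₀) w = 0`. [folklore] -/
theorem tangency_quadForm_derivative_eq_zero (e : ℕ) (d : Fin K → ℕ) (J : Matrix (Fin 2) (Fin 2) ℝ)
    (P : Fin K → Matrix (Fin 2) (Fin 2) ℝ) (hJ : J.IsSymm) (hP : ∀ k, (P k).IsSymm) (u₀ : ℝ)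
    (hroot : ((((Polynomial.X : ℝ[X]) ^ e) • Matrix.map J Polynomial.C
      + ∑ k, ((Polynomial.X : ℝ[X]) ^ d k) • Matrix.map (P k) Polynomial.C)).det.eval u₀ = 0)
    (hder : (Polynomial.derivative ((((Polynomial.X : ℝ[X]) ^ e) • Matrix.map J Polynomial.C
      + ∑ k, ((Polynomial.X : ℝ[X]) ^ d k) • Matrix.map (P k) Polynomial.C)).det).eval u₀ = 0)
    (hne : (u₀ ^ e • J + ∑ k, u₀ ^ d k • P k) ≠ 0) (w : Fin 2 → ℝ) (hw : ((u₀ ^ e • J + ∑ k, u₀ ^ d k • P k)).mulVec w = 0) :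
    dotProduct w ((((((e : ℕ) : ℝ) * u₀ ^ (e - 1)) • J + ∑ k, (((d k : ℕ) : ℝ) * u₀ ^ (d k - 1)) • P k)).mulVec w) = 0 := by
  -- symmetry of the value and derivative matrices
  have hsymV : (u₀ ^ e • J + ∑ k, u₀ ^ d k • P k) 1 0 = (u₀ ^ e • J + ∑ k, u₀ ^ d k • P k) 0 1 := by
    have h1 : J 1 0 = J 0 1 := by simpa using congrFun (congrFun hJ 0) 1
    have h2 : ∀ k, P k 1 0 = P k 0 1 := fun k => by simpa using congrFun (congrFun (hP k) 0) 1
    simp [Matrix.add_apply, Matrix.smul_apply, Matrix.sum_apply, h1, h2]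
  have hsymD : ((((e : ℕ) : ℝ) * u₀ ^ (e - 1)) • J + ∑ k, (((d k : ℕ) : ℝ) * u₀ ^ (d k - 1)) • P k) 1 0 = ((((e : ℕ) : ℝ) * u₀ ^ (e - 1)) • J + ∑ k, (((d k : ℕ) : ℝ) * u₀ ^ (d k - 1)) • P k) 0 1 := by
    have h1 : J 1 0 = J 0 1 := by simpa using congrFun (congrFun hJ 0) 1
    have h2 : ∀ k, P k 1 0 = P k 0 1 := fun k => by simpa using congrFun (congrFun (hP k) 0) 1
    simp [Matrix.add_apply, Matrix.smul_apply, Matrix.sum_apply, h1, h2]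
  set a := (u₀ ^ e • J + ∑ k, u₀ ^ d k • P k) 0 0
  set b := (u₀ ^ e • J + ∑ k, u₀ ^ d k • P k) 0 1
  set c := (u₀ ^ e • J + ∑ k, u₀ ^ d k • P k) 1 1
  set a' := ((((e : ℕ) : ℝ) * u₀ ^ (e - 1)) • J + ∑ k, (((d k : ℕ) : ℝ) * u₀ ^ (d k - 1)) • P k) 0 0
  set b' := ((((e : ℕ) : ℝ) * u₀ ^ (e - 1)) • J + ∑ k, (((d k : ℕ) : ℝ) * u₀ ^ (d k - 1)) • P k) 0 1
  set c' := ((((e : ℕ) : ℝ) * u₀ ^ (e - 1)) • J + ∑ k, (((d k : ℕ) : ℝ) * u₀ ^ (d k - 1)) • P k) 1 1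
  rw [eval_det_pencil] at hroot
  rw [eval_derivative_det_pencil] at hder
  rw [hsymV] at hroot hder
  rw [hsymD] at hder
  -- kernel equations
  have hk0 := congrFun hw 0
  have hk1 := congrFun hw 1
  simp only [Matrix.mulVec, dotProduct, Fin.sum_univ_two, Pi.zero_apply] at hk0 hk1
  rw [hsymV] at hk1
  -- the non-vanishing of F(u₀)
  have hne' : ¬ (a = 0 ∧ b = 0 ∧ c = 0) := by
    rintro ⟨ha, hb, hc⟩
    apply hne
    ext i j
    fin_cases i <;> fin_cases j
    · exact ha
    · exact hb
    · simpa [hsymV] using hb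
    · exact hc
  have hcore := core_isotropic a b c a' b' c' (w 0) (w 1) (by nlinarith [hroot]) hne' (by linarith [hder])
    (by linarith [hk0]) (by linarith [hk1])
  -- unfold the quadratic form of the derivative matrix
  simp only [Matrix.mulVec, dotProduct, Fin.sum_univ_two]
  rw [hsymD]
  linear_combination hcore

/-- `wᵀ F(u₀) w = 0` for a kernel vector (trivial). -/
theorem quadForm_value_eq_zero (e : ℕ) (d : Fin K → ℕ) (J : Matrix (Fin 2) (Fin 2) ℝ)
    (P : Fin K → Matrix (Fin 2) (Fin 2) ℝ) (u₀ : ℝ) (w : Fin 2 → ℝ)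
    (hw : ((u₀ ^ e • J + ∑ k, u₀ ^ d k • P k)).mulVec w = 0) : dotProduct w (((u₀ ^ e • J + ∑ k, u₀ ^ d k • P k)).mulVec w) = 0 := by
  rw [hw, dotProduct_zero]

/-- Quadratic form of the value matrix, letter by letter:
`wᵀ F(u) w = u^e · wᵀ J w + ∑ₖ u^{d k} · wᵀ (P k) w`. -/
theorem quadForm_valueAt (e : ℕ) (d : Fin K → ℕ) (J : Matrix (Fin 2) (Fin 2) ℝ)
    (P : Fin K → Matrix (Fin 2) (Fin 2) ℝ) (u : ℝ) (w : Fin 2 → ℝ) :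
    dotProduct w (((u ^ e • J + ∑ k, u ^ d k • P k)).mulVec w)
      = u ^ e * dotProduct w (J.mulVec w) + ∑ k, u ^ d k * dotProduct w ((P k).mulVec w) := by
  simp only [Matrix.add_mulVec, Matrix.smul_mulVec, dotProduct_add, dotProduct_smul,
    smul_eq_mul, Matrix.sum_mulVec, dotProduct_sum]

/-- Quadratic form of the derivative matrix, letter by letter:
`wᵀ F'(u) w = e u^{e−1} · wᵀ J w + ∑ₖ (d k) u^{d k − 1} · wᵀ (P k) w`. -/
theorem quadForm_derivAt (e : ℕ) (d : Fin K → ℕ) (J : Matrix (Fin 2) (Fin 2) ℝ)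
    (P : Fin K → Matrix (Fin 2) (Fin 2) ℝ) (u : ℝ) (w : Fin 2 → ℝ) :
    dotProduct w ((((((e : ℕ) : ℝ) * u ^ (e - 1)) • J + ∑ k, (((d k : ℕ) : ℝ) * u ^ (d k - 1)) • P k)).mulVec w)
      = ((e : ℝ) * u ^ (e - 1)) * dotProduct w (J.mulVec w)
        + ∑ k, ((d k : ℝ) * u ^ (d k - 1)) * dotProduct w ((P k).mulVec w) := by
  simp only [Matrix.add_mulVec, Matrix.smul_mulVec, dotProduct_add, dotProduct_smul,
    smul_eq_mul, Matrix.sum_mulVec, dotProduct_sum]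

/-- **BALANCE LAW.**  Under the hypotheses of the tangency law, for every kernel vector `w` of `F(u₀)`:
`∑ₖ (d k − e) · u₀^{d k} · wᵀ (P k) w = 0` — in a kernel direction at a multiple root, the letters
above the pivot exponent balance the letters below it (weights `|d k − e| u₀^{d k} wᵀ P_k w`).  No sign
hypothesis on `J`, `P k`; `d k − e` is the real difference. [folklore] -/
theorem tangency_balance (e : ℕ) (d : Fin K → ℕ) (J : Matrix (Fin 2) (Fin 2) ℝ)
    (P : Fin K → Matrix (Fin 2) (Fin 2) ℝ) (hJ : J.IsSymm) (hP : ∀ k, (P k).IsSymm) (u₀ : ℝ)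
    (hroot : ((((Polynomial.X : ℝ[X]) ^ e) • Matrix.map J Polynomial.C
      + ∑ k, ((Polynomial.X : ℝ[X]) ^ d k) • Matrix.map (P k) Polynomial.C)).det.eval u₀ = 0)
    (hder : (Polynomial.derivative ((((Polynomial.X : ℝ[X]) ^ e) • Matrix.map J Polynomial.C
      + ∑ k, ((Polynomial.X : ℝ[X]) ^ d k) • Matrix.map (P k) Polynomial.C)).det).eval u₀ = 0)
    (hne : (u₀ ^ e • J + ∑ k, u₀ ^ d k • P k) ≠ 0) (w : Fin 2 → ℝ) (hw : ((u₀ ^ e • J + ∑ k, u₀ ^ d k • P k)).mulVec w = 0) :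
    ∑ k, (((d k : ℝ) - e) * u₀ ^ d k) * dotProduct w ((P k).mulVec w) = 0 := by
  have h1 := quadForm_value_eq_zero e d J P u₀ w hw
  have h2 := tangency_quadForm_derivative_eq_zero e d J P hJ hP u₀ hroot hder hne w hw
  rw [quadForm_valueAt] at h1
  rw [quadForm_derivAt] at h2
  -- u₀ · (wᵀ F' w) = e u₀^e wᵀJw + ∑ d_k u₀^{d_k} wᵀP_kw
  have h3 : (e : ℝ) * u₀ ^ e * dotProduct w (J.mulVec w)
      + ∑ k, ((d k : ℝ) * u₀ ^ d k) * dotProduct w ((P k).mulVec w) = 0 := by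
    have := congrArg (fun x => u₀ * x) h2
    simp only [mul_zero, mul_add, Finset.mul_sum] at this
    rw [← this]
    congr 1
    · rw [← mul_assoc, SecularRolle.mul_natCast_mul_pow_pred]
    · refine Finset.sum_congr rfl fun k _ => ?_
      rw [← mul_assoc, SecularRolle.mul_natCast_mul_pow_pred]
  -- subtract e × h1
  have h4 := congrArg (fun x => (e : ℝ) * x) h1
  simp only [mul_zero, mul_add, Finset.mul_sum] at h4
  have : ∑ k, (((d k : ℝ) - e) * u₀ ^ d k) * dotProduct w ((P k).mulVec w)
      = (∑ k, ((d k : ℝ) * u₀ ^ d k) * dotProduct w ((P k).mulVec w))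
        - ∑ k, (e : ℝ) * (u₀ ^ d k * dotProduct w ((P k).mulVec w)) := by
    rw [← Finset.sum_sub_distrib]
    refine Finset.sum_congr rfl fun k _ => ?_
    ring
  rw [this]
  linear_combination h3 - h4

/-- The quadratic form of the velocity letter is the balance sum. -/
theorem quadForm_velocityAt (e : ℕ) (d : Fin K → ℕ) (P : Fin K → Matrix (Fin 2) (Fin 2) ℝ) (u : ℝ)
    (w : Fin 2 → ℝ) :
    dotProduct w (((∑ k, ((((d k : ℕ) : ℝ) - ((e : ℕ) : ℝ)) * u ^ d k) • P k)).mulVec w)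
      = ∑ k, (((d k : ℝ) - e) * u ^ d k) * dotProduct w ((P k).mulVec w) := by
  simp only [Matrix.smul_mulVec, dotProduct_smul, smul_eq_mul, Matrix.sum_mulVec,
    dotProduct_sum]

/-- **The velocity letter is not definite at a multiple root.**  Under the hypotheses of the tangency law
(the kernel vector `w ≠ 0` exists because `det F(u₀) = 0`), `det B(u₀) ≤ 0` for
`B(u₀) = ∑ₖ (d k − e) u₀^{d k} • P k`: with `P k ⪰ 0` this says the letter curve's velocity
`u₀ A'(u₀) − e A(u₀)` is spacelike or null (indefinite or singular) at every double root of `det F`,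
at every level of the pivot. [folklore] -/
theorem tangency_det_velocity_nonpos (e : ℕ) (d : Fin K → ℕ) (J : Matrix (Fin 2) (Fin 2) ℝ)
    (P : Fin K → Matrix (Fin 2) (Fin 2) ℝ) (hJ : J.IsSymm) (hP : ∀ k, (P k).IsSymm) (u₀ : ℝ)
    (hroot : ((((Polynomial.X : ℝ[X]) ^ e) • Matrix.map J Polynomial.C
      + ∑ k, ((Polynomial.X : ℝ[X]) ^ d k) • Matrix.map (P k) Polynomial.C)).det.eval u₀ = 0)
    (hder : (Polynomial.derivative ((((Polynomial.X : ℝ[X]) ^ e) • Matrix.map J Polynomial.C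
      + ∑ k, ((Polynomial.X : ℝ[X]) ^ d k) • Matrix.map (P k) Polynomial.C)).det).eval u₀ = 0)
    (hne : (u₀ ^ e • J + ∑ k, u₀ ^ d k • P k) ≠ 0) :
    ((∑ k, ((((d k : ℕ) : ℝ) - ((e : ℕ) : ℝ)) * u₀ ^ d k) • P k)).det ≤ 0 := by
  -- a non-zero kernel vector of the singular matrix F(u₀)
  have hdet0 : ((u₀ ^ e • J + ∑ k, u₀ ^ d k • P k)).det = 0 := by
    rw [eval_det_pencil] at hroot
    rw [Matrix.det_fin_two]
    linarith
  obtain ⟨w, hw0, hw⟩ := Matrix.exists_mulVec_eq_zero_iff.2 hdet0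
  have hbal := tangency_balance e d J P hJ hP u₀ hroot hder hne w hw
  rw [← quadForm_velocityAt] at hbal
  -- symmetric entries of B
  have hsym : (∑ k, ((((d k : ℕ) : ℝ) - ((e : ℕ) : ℝ)) * u₀ ^ d k) • P k) 1 0 = (∑ k, ((((d k : ℕ) : ℝ) - ((e : ℕ) : ℝ)) * u₀ ^ d k) • P k) 0 1 := by
    have h2 : ∀ k, P k 1 0 = P k 0 1 := fun k => by simpa using congrFun (congrFun (hP k) 0) 1
    simp [Matrix.smul_apply, Matrix.sum_apply, h2]
  have hform : (∑ k, ((((d k : ℕ) : ℝ) - ((e : ℕ) : ℝ)) * u₀ ^ d k) • P k) 0 0 * w 0 ^ 2 + 2 * (∑ k, ((((d k : ℕ) : ℝ) - ((e : ℕ) : ℝ)) * u₀ ^ d k) • P k) 0 1 * w 0 * w 1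
      + (∑ k, ((((d k : ℕ) : ℝ) - ((e : ℕ) : ℝ)) * u₀ ^ d k) • P k) 1 1 * w 1 ^ 2 = 0 := by
    simp only [Matrix.mulVec, dotProduct, Fin.sum_univ_two] at hbal
    rw [hsym] at hbal
    linear_combination hbal
  have hw0' : ¬ (w 0 = 0 ∧ w 1 = 0) := by
    rintro ⟨h0, h1⟩; apply hw0; ext i; fin_cases i <;> assumption
  have := det_nonpos_of_isotropic _ _ _ _ _ hw0' hform
  rw [Matrix.det_fin_two, hsym]
  nlinarith [this]

end Summit.ValiantsHypothesis.ValiantsHypothesis.Theorems.LacunarySymmetroidMatrixDescartes.Pivot.Tangency
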